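import Summits.KontsevichZagierPeriods.KontsevichZagierPeriods.Theses.HyperbolicBloch
import Literature.NumberTheory.Transcendental.KZSemiCanonicalReductionProofs
import Literature.NumberTheory.Transcendental.KZCalculusProofs

/-!
# `HyperbolicBloch.PachnerTwoThree` — the 2–3 Pachner move is a KZ relation

Crux stmt-KontsevichZagierPeriods-3470 of route HyperbolicBloch, line `exchange-identity-symmdiff`
(skeleton owned by the lead prover).  For `q̂ = (Re q, Im q, 0)` strictly inside the
counter-clockwise ideal triangle `(u, v, w)` and five KZ integral representations on the typed
domains of the crux — the prism `P(u,v,w)` above the hemisphere `S u v w = 0`, the inner ideal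
tetrahedron `(q; u, v, w)` and the three prisms `P(u,v,q)`, `P(v,w,q)`, `P(w,u,q)` — carrying the
integrand `t⁻³`, we show `[P(uvw)] + [inner] − [P(uvq)] − [P(vwq)] − [P(wuq)] ∈ KZ.relations`.

Composition (`PachnerTwoThree_of`, sorry-free modulo the two registered stubs):
* `stub_exchangePointwise` — the POINTWISE 2–3 indicator identity off the scaffold
  `{S u v w = 0} ∪ {L u q = 0} ∪ {L v q = 0} ∪ {L w q = 0}` (exchange / radical-plane identities);
* `stub_nullScaffold` — the scaffold is Lebesgue-null (zero sets of non-zero polynomials);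
* bookkeeping here: glue `rP`, `rI` (one `domainAddRel` move, the two domains are disjoint by the
  sign of `S u v w`), then the tree's iterated domain additivity
  `KZ.of_sub_sum_of_mem_relations` over the almost-partition `r₁, r₂, r₃` of the glued domain
  (pairwise overlaps EMPTY by antisymmetry of `L`; defects inside the null scaffold).
The `IsAlgebraic` hypotheses and the particular integrand are not needed
(`pachnerTwoThree_general`: any common integrand).  The two unions are NOT equal as sets
(`Theorems/PachnerTwoThree/Negative/ExactUnion`), so null pieces are unavoidable; each strict
interior hypothesis is load-bearing (Disproof `pachnerTwoThree_false_without_interior₁/₂/₃`).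
Architecture adapted from the standing disprover's kernel-checked `Cruxes/PachnerTwoThree/Disproof.lean`
§4 (refuter-cdisprove g2, 2026-08-15).

References: J. Dupont, C.-H. Sah, *Scissors congruences II*, J. Pure Appl. Algebra 25 (1982) (5.3);
W. Neumann, *Hilbert's 3rd problem and invariants of 3-manifolds* (1998) §2; M. Kontsevich,
D. Zagier, *Periods* (2001) §1.2 rule (1a).
-/

noncomputable section

open Set MeasureTheory
open Literature.NumberTheory.Transcendental

namespace Summit.KontsevichZagierPeriods.HyperbolicBloch.PachnerTwoThree

/-- **Stub `stub_exchangePointwise`** (line `exchange-identity-symmdiff`): the pointwise 2–3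
indicator identity off the null scaffold, for the crux's verbatim `L`, `S` — for `q̂` strictly
inside the ccw triangle `(u,v,w)` and `p` with `S u v w p · L u q p · L v q p · L w q p ≠ 0`,
`p ∈ P(uvw) ∪ inner ↔ p ∈ P(uvq) ∪ P(vwq) ∪ P(wuq)`. -/
theorem stub_exchangePointwise : ∀ (L : ℂ → ℂ → (Fin 3 → ℝ) → ℝ), (∀ u v p, L u v p = (v.re - u.re) * (p 1 - u.im) - (v.im - u.im) * (p 0 - u.re)) → ∀ (S : ℂ → ℂ → ℂ → (Fin 3 → ℝ) → ℝ), (∀ u v w p, S u v w p = (p 0 ^ 2 + p 1 ^ 2 + p 2 ^ 2) * (u.re * (v.im - w.im) - u.im * (v.re - w.re) + (v.re * w.im - v.im * w.re)) - p 0 * (Complex.normSq u * (v.im - w.im) - u.im * (Complex.normSq v - Complex.normSq w) + (Complex.normSq v * w.im - v.im * Complex.normSq w)) + p 1 * (Complex.normSq u * (v.re - w.re) - u.re * (Complex.normSq v - Complex.normSq w) + (Complex.normSq v * w.re - v.re * Complex.normSq w)) - (Complex.normSq u * (v.re * w.im - v.im * w.re) - u.re * (Complex.normSq v * w.im - v.im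 * Complex.normSq w) + u.im * (Complex.normSq v * w.re - v.re * Complex.normSq w))) → ∀ (u v w q : ℂ), 0 < L u v ![q.re, q.im, 0] → 0 < L v w ![q.re, q.im, 0] → 0 < L w u ![q.re, q.im, 0] → ∀ (p : Fin 3 → ℝ), S u v w p ≠ 0 → L u q p ≠ 0 → L v q p ≠ 0 → L w q p ≠ 0 → (((0 < p 2 ∧ 0 < L u v p ∧ 0 < L v w p ∧ 0 < L w u p ∧ 0 < S u v w p) ∨ (0 < p 2 ∧ S u v w p < 0 ∧ 0 < S u v q p ∧ 0 < S v w q p ∧ 0 < S w u q p)) ↔ ((0 < p 2 ∧ 0 < L u v p ∧ 0 < L v q p ∧ 0 < L q u p ∧ 0 < S u v q p) ∨ (0 < p 2 ∧ 0 < L v w p ∧ 0 < L w q p ∧ 0 < L q v p ∧ 0 < S v w q p) ∨ (0 < p 2 ∧ 0 < L w u p ∧ 0 < L u q p ∧ 0 < L q w p ∧ 0 < S w u q p))) := by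
  sorry

/-- **Stub `stub_nullScaffold`** (line `exchange-identity-symmdiff`): for `q̂` strictly inside the
ccw triangle `(u,v,w)` the scaffold of the 2–3 move — the big sphere `S u v w = 0` and the three
spoke planes `L u q = 0`, `L v q = 0`, `L w q = 0` — is Lebesgue-null. -/
theorem stub_nullScaffold : ∀ (L : ℂ → ℂ → (Fin 3 → ℝ) → ℝ), (∀ u v p, L u v p = (v.re - u.re) * (p 1 - u.im) - (v.im - u.im) * (p 0 - u.re)) → ∀ (S : ℂ → ℂ → ℂ → (Fin 3 → ℝ) → ℝ), (∀ u v w p, S u v w p = (p 0 ^ 2 + p 1 ^ 2 + p 2 ^ 2) * (u.re * (v.im - w.im) - u.im * (v.re - w.re) + (v.re * w.im - v.im * w.re)) - p 0 * (Complex.normSq u * (v.im - w.im) - u.im * (Complex.normSq v - Complex.normSq w) + (Complex.normSq v * w.im - v.im * Complex.normSq w)) + p 1 * (Complex.normSq u * (v.re - w.re) - u.re * (Complex.normSq v - Complex.normSq w) + (Complex.normSq v * w.re - v.re * Complex.normSq w)) - (Complex.normSq u * (v.re * w.im - v.im * w.re) - u.re * (Complex.normSq v * w.im - v.im * Complex.normSq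 w) + u.im * (Complex.normSq v * w.re - v.re * Complex.normSq w))) → ∀ (u v w q : ℂ), 0 < L u v ![q.re, q.im, 0] → 0 < L v w ![q.re, q.im, 0] → 0 < L w u ![q.re, q.im, 0] → MeasureTheory.volume {p : Fin 3 → ℝ | S u v w p = 0 ∨ L u q p = 0 ∨ L v q p = 0 ∨ L w q p = 0} = 0 := by
  sorry

/-- Iterated domain additivity over an almost-partition into three pieces: the tree's
`KZ.of_sub_sum_of_mem_relations` (Kontsevich–Zagier rule (1a) modulo null sets) specialised to
the index set `Fin 3`. -/
theorem of_sub_three_mem_relations {n : ℕ} (r R₁ R₂ R₃ : KZ.IntegralRep n)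
    (hd₁ : volume (R₁.domain \ r.domain) = 0) (hd₂ : volume (R₂.domain \ r.domain) = 0)
    (hd₃ : volume (R₃.domain \ r.domain) = 0)
    (hi₁ : EqOn R₁.integrand r.integrand (R₁.domain ∩ r.domain))
    (hi₂ : EqOn R₂.integrand r.integrand (R₂.domain ∩ r.domain))
    (hi₃ : EqOn R₃.integrand r.integrand (R₃.domain ∩ r.domain))
    (hcov : volume (r.domain \ (R₁.domain ∪ R₂.domain ∪ R₃.domain)) = 0)
    (h12 : volume (R₁.domain ∩ R₂.domain) = 0) (h13 : volume (R₁.domain ∩ R₃.domain) = 0)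
    (h23 : volume (R₂.domain ∩ R₃.domain) = 0) :
    KZ.of r - KZ.of R₁ - KZ.of R₂ - KZ.of R₃ ∈ KZ.relations := by
  set R : Fin 3 → KZ.IntegralRep n := ![R₁, R₂, R₃] with hR
  have h := KZ.of_sub_sum_of_mem_relations (Finset.univ : Finset (Fin 3)) r R
    (fun i _ => by fin_cases i <;> simpa [hR] using by assumption)
    (fun i _ => by fin_cases i <;> simpa [hR] using by assumption)
    (by
      have : (⋃ i ∈ (Finset.univ : Finset (Fin 3)), (R i).domain) =
          R₁.domain ∪ R₂.domain ∪ R₃.domain := by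
        ext p
        simp only [Finset.mem_univ, iUnion_true, mem_iUnion, mem_union, hR]
        constructor
        · rintro ⟨i, hi⟩
          fin_cases i
          · exact Or.inl (Or.inl (by simpa using hi))
          · exact Or.inl (Or.inr (by simpa using hi))
          · exact Or.inr (by simpa using hi)
        · rintro ((hi | hi) | hi)
          · exact ⟨0, by simpa using hi⟩
          · exact ⟨1, by simpa using hi⟩
          · exact ⟨2, by simpa using hi⟩
      rw [this]; exact hcov)
    (by
      intro i _ j _ hij
      fin_cases i <;> fin_cases j
      · exact absurd rfl hij
      · simpa [hR] using h12
      · simpa [hR] using h13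
      · simpa [hR, inter_comm] using h12
      · exact absurd rfl hij
      · simpa [hR] using h23
      · simpa [hR, inter_comm] using h13
      · simpa [hR, inter_comm] using h23
      · exact absurd rfl hij)
  have hsum : ∑ i ∈ (Finset.univ : Finset (Fin 3)), KZ.of (R i) = KZ.of R₁ + KZ.of R₂ + KZ.of R₃ := by
    rw [Fin.sum_univ_three]; simp [hR]
  rw [hsum] at h
  have e : KZ.of r - KZ.of R₁ - KZ.of R₂ - KZ.of R₃ = KZ.of r - (KZ.of R₁ + KZ.of R₂ + KZ.of R₃) := by
    abel
  rw [e]; exact h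

section General

variable {L : ℂ → ℂ → (Fin 3 → ℝ) → ℝ} {S : ℂ → ℂ → ℂ → (Fin 3 → ℝ) → ℝ}

variable (hL : ∀ u v p, L u v p = (v.re - u.re) * (p 1 - u.im) - (v.im - u.im) * (p 0 - u.re))
  (hS : ∀ u v w p, S u v w p = (p 0 ^ 2 + p 1 ^ 2 + p 2 ^ 2) * (u.re * (v.im - w.im) - u.im * (v.re - w.re) + (v.re * w.im - v.im * w.re)) - p 0 * (Complex.normSq u * (v.im - w.im) - u.im * (Complex.normSq v - Complex.normSq w) + (Complex.normSq v * w.im - v.im * Complex.normSq w)) + p 1 * (Complex.normSq u * (v.re - w.re) - u.re * (Complex.normSq v - Complex.normSq w) + (Complex.normSq v * w.re - v.re * Complex.normSq w)) - (Complex.normSq u * (v.re * w.im - v.im * w.re) - u.re * (Complex.normSq v * w.im - v.im * Complex.normSq w) + u.im * (Complex.normSq v * w.re - v.re * Complex.normSq w)))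
include hL hS

/-- **The 2–3 move is a KZ relation — general form.**  No algebraicity of `u v w q` and no
particular integrand is needed: for ANY five representations on the five typed domains whose
integrands agree with one common function `f` on their domains,
`[rP] + [rI] − [r₁] − [r₂] − [r₃] ∈ KZ.relations`.  Moves used: one `domainAddRel` (glue `rP`,
`rI`, disjoint) and the tree's iterated domain additivity over the almost-partition `r₁, r₂, r₃`
of the glued domain (overlaps empty, defects inside the null scaffold). -/
theorem pachnerTwoThree_general {u v w q : ℂ} (h1 : 0 < L u v ![q.re, q.im, 0])
    (h2 : 0 < L v w ![q.re, q.im, 0]) (h3 : 0 < L w u ![q.re, q.im, 0]) (f : (Fin 3 → ℝ) → ℝ)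
    (rP rI r₁ r₂ r₃ : KZ.IntegralRep 3)
    (hP : rP.domain = {p | 0 < p 2 ∧ 0 < L u v p ∧ 0 < L v w p ∧ 0 < L w u p ∧ 0 < S u v w p})
    (hI : rI.domain = {p | 0 < p 2 ∧ S u v w p < 0 ∧ 0 < S u v q p ∧ 0 < S v w q p ∧ 0 < S w u q p})
    (hr₁ : r₁.domain = {p | 0 < p 2 ∧ 0 < L u v p ∧ 0 < L v q p ∧ 0 < L q u p ∧ 0 < S u v q p})
    (hr₂ : r₂.domain = {p | 0 < p 2 ∧ 0 < L v w p ∧ 0 < L w q p ∧ 0 < L q v p ∧ 0 < S v w q p})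
    (hr₃ : r₃.domain = {p | 0 < p 2 ∧ 0 < L w u p ∧ 0 < L u q p ∧ 0 < L q w p ∧ 0 < S w u q p})
    (fP : EqOn rP.integrand f rP.domain) (fI : EqOn rI.integrand f rI.domain)
    (f₁ : EqOn r₁.integrand f r₁.domain) (f₂ : EqOn r₂.integrand f r₂.domain)
    (f₃ : EqOn r₃.integrand f r₃.domain) :
    KZ.of rP + KZ.of rI - KZ.of r₁ - KZ.of r₂ - KZ.of r₃ ∈ KZ.relations := by
  -- the null scaffold and the pointwise identity off it (the two stubs)
  set Z : Set (Fin 3 → ℝ) := {p | S u v w p = 0 ∨ L u q p = 0 ∨ L v q p = 0 ∨ L w q p = 0}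
    with hZ_def
  have hZ : volume Z = 0 := stub_nullScaffold L hL S hS u v w q h1 h2 h3
  have hpt : ∀ p, p ∉ Z → ((p ∈ rP.domain ∨ p ∈ rI.domain) ↔
      (p ∈ r₁.domain ∨ p ∈ r₂.domain ∨ p ∈ r₃.domain)) := by
    intro p hp
    simp only [hZ_def, mem_setOf_eq, not_or] at hp
    rw [hP, hI, hr₁, hr₂, hr₃]
    simp only [mem_setOf_eq]
    exact stub_exchangePointwise L hL S hS u v w q h1 h2 h3 p hp.1 hp.2.1 hp.2.2.1 hp.2.2.2
  -- glue rP and rI (disjoint by the sign of `S u v w`)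
  have hdisj : Disjoint rP.domain rI.domain := by
    rw [Set.disjoint_left]
    intro p hp hp'
    rw [hP] at hp
    rw [hI] at hp'
    exact absurd hp.2.2.2.2 (not_lt.mpr hp'.2.1.le)
  set r := rP.glue rI hdisj with hr_def
  have hglue : KZ.of r - KZ.of rP - KZ.of rI ∈ KZ.relations :=
    KZ.domainAddRel_subset_relations (KZ.IntegralRep.of_glue_sub_sub_mem_domainAddRel rP rI hdisj)
  have hrint : EqOn r.integrand f r.domain := by
    intro p hp
    rcases hp with hp | hp
    · rw [KZ.IntegralRep.eqOn_integrand_glue_left rP rI hdisj hp]; exact fP hp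
    · rw [KZ.IntegralRep.eqOn_integrand_glue_right rP rI hdisj hp]; exact fI hp
  -- a.e. inclusions via the scaffold
  have sub₁ : r₁.domain \ r.domain ⊆ Z := by
    intro p hp
    by_contra hz
    exact hp.2 ((hpt p hz).mpr (Or.inl hp.1))
  have sub₂ : r₂.domain \ r.domain ⊆ Z := by
    intro p hp
    by_contra hz
    exact hp.2 ((hpt p hz).mpr (Or.inr (Or.inl hp.1)))
  have sub₃ : r₃.domain \ r.domain ⊆ Z := by
    intro p hp
    by_contra hz
    exact hp.2 ((hpt p hz).mpr (Or.inr (Or.inr hp.1)))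
  have subc : r.domain \ (r₁.domain ∪ r₂.domain ∪ r₃.domain) ⊆ Z := by
    intro p hp
    by_contra hz
    have := (hpt p hz).mp hp.1
    rcases this with h | h | h
    · exact hp.2 (Or.inl (Or.inl h))
    · exact hp.2 (Or.inl (Or.inr h))
    · exact hp.2 (Or.inr h)
  -- pairwise disjointness of the three prisms (antisymmetry of `L`)
  have e12 : r₁.domain ∩ r₂.domain = ∅ := by
    ext p
    simp only [mem_inter_iff, mem_empty_iff_false, iff_false, not_and]
    intro hp hp'
    rw [hr₁] at hp
    rw [hr₂] at hp'
    have : L q v p = -L v q p := by rw [hL, hL]; ring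
    linarith [hp.2.2.1, hp'.2.2.2.1]
  have e13 : r₁.domain ∩ r₃.domain = ∅ := by
    ext p
    simp only [mem_inter_iff, mem_empty_iff_false, iff_false, not_and]
    intro hp hp'
    rw [hr₁] at hp
    rw [hr₃] at hp'
    have : L q u p = -L u q p := by rw [hL, hL]; ring
    linarith [hp.2.2.2.1, hp'.2.2.1]
  have e23 : r₂.domain ∩ r₃.domain = ∅ := by
    ext p
    simp only [mem_inter_iff, mem_empty_iff_false, iff_false, not_and]
    intro hp hp'
    rw [hr₂] at hp
    rw [hr₃] at hp'
    have : L q w p = -L w q p := by rw [hL, hL]; ring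
    linarith [hp.2.2.1, hp'.2.2.2.1]
  have hsplit : KZ.of r - KZ.of r₁ - KZ.of r₂ - KZ.of r₃ ∈ KZ.relations :=
    of_sub_three_mem_relations r r₁ r₂ r₃ (measure_mono_null sub₁ hZ)
      (measure_mono_null sub₂ hZ) (measure_mono_null sub₃ hZ)
      (fun p hp => by rw [f₁ hp.1, hrint hp.2]) (fun p hp => by rw [f₂ hp.1, hrint hp.2])
      (fun p hp => by rw [f₃ hp.1, hrint hp.2]) (measure_mono_null subc hZ)
      (by rw [e12, measure_empty]) (by rw [e13, measure_empty]) (by rw [e23, measure_empty])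
  have e : KZ.of rP + KZ.of rI - KZ.of r₁ - KZ.of r₂ - KZ.of r₃ =
      (KZ.of r - KZ.of r₁ - KZ.of r₂ - KZ.of r₃) - (KZ.of r - KZ.of rP - KZ.of rI) := by abel
  rw [e]
  exact KZ.relations.sub_mem hsplit hglue

end General

/-- **The crux `HyperbolicBloch.PachnerTwoThree` (stmt-KontsevichZagierPeriods-3470).**  The 2–3
Pachner move with apexes `∞` and an interior point is a KZ relation:
`[P(uvw)] + [inner(q;uvw)] − [P(uvq)] − [P(vwq)] − [P(wuq)] ∈ KZ.relations`, from
`pachnerTwoThree_general` with `f = t⁻³`; the `IsAlgebraic` hypotheses and the `P`-abbreviation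
are discharged syntactically. -/
theorem PachnerTwoThree_of :
    Summit.KontsevichZagierPeriods.KontsevichZagierPeriods.Theses.HyperbolicBloch.PachnerTwoThree := by
  intro L hL S hS P hP u v w q _ _ _ _ h1 h2 h3 rP rI r₁ r₂ r₃ dP dI d₁ d₂ d₃ fP fI f₁ f₂ f₃
  rw [hP] at dP d₁ d₂ d₃
  exact pachnerTwoThree_general hL hS h1 h2 h3 (fun p => 1 / p 2 ^ 3) rP rI r₁ r₂ r₃ dP dI d₁ d₂ d₃
    fP fI f₁ f₂ f₃

end Summit.KontsevichZagierPeriods.HyperbolicBloch.PachnerTwoThree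

end
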